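import Summits.Ventures.PercRepro.RankLevelSetPlaneSix

/-!
# PercRepro — every point of a 6-point plane of the e-free core lies on a 3-point line of that plane (p1, gen 21)

`proofs/P1-S4-PERPOINT.md` §2. On the e-free core (night-1's `hfree` at every point), a set `P` of rank `≤ 3` with
`6` points has, through each of its points `y`, a rank-`2` triple `{y, u, v} ⊆ P`. PROOF: otherwise `Q := P ∖ {y}`
has 5 points; for each `z ∈ Q` the two sides of `z` inside `P` (`ThmN.exists_two_sides_of_free`) are sets of rank
`≤ 2`, hence of `≤ 3` points, covering the 5 points of `P ∖ {z}`; the 3-point side is a rank-`2` triple avoiding `z`,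
and it avoids `y` (a rank-`2` triple through `y` is what we are refuting), so every `z ∈ Q` misses a rank-`2`
triple `T_z ⊆ Q`. Two distinct rank-`2` triples share at most one point (else their union has rank `2` and `4`
points). Chasing three of them (`T_{z₁}`, then `T_a` for `a ∈ T_{z₁}`, then `T_c` for the third point `c` of
`T_{z₁}`) is impossible inside 5 points.
Axioms: standard.
-/

open scoped Matroid

namespace PercRepro

namespace S1

open Set

variable {α : Type}

/-- Two distinct rank-`≤ 2` triples of the e-free core share at most one point. -/
theorem inter_ncard_le_one_of_triples (M : Matroid α) [M.Finite]
    (hfree : ∀ e ∈ M.E, ∃ A ⊆ M.E \ {e}, e ∉ M.closure A ∧ e ∉ M.closure ((M.E \ {e}) \ A))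
    {T T' : Set α} (hT : T ⊆ M.E) (hT' : T' ⊆ M.E) (hrT : M.eRk T ≤ 2) (hrT' : M.eRk T' ≤ 2)
    (h3 : T.ncard = 3) (h3' : T'.ncard = 3) (hne : T ≠ T') : (T ∩ T').ncard ≤ 1 := by
  by_contra hlt
  push Not at hlt
  have hTfin : T.Finite := M.ground_finite.subset hT
  have hT'fin : T'.Finite := M.ground_finite.subset hT'
  have hint : (2 : ℕ∞) ≤ M.eRk (T ∩ T') :=
    ThmN.two_le_eRk_of_two_le_ncard_of_free M hfree (inter_subset_left.trans hT) (by omega)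
  have hsub := M.eRk_inter_add_eRk_union_le T T'
  have hun : M.eRk (T ∪ T') ≤ 2 := by
    have h4 : M.eRk (T ∩ T') + M.eRk (T ∪ T') ≤ (2 : ℕ∞) + 2 := hsub.trans (add_le_add hrT hrT')
    have h5 : (2 : ℕ∞) + M.eRk (T ∪ T') ≤ 2 + 2 := by
      calc (2 : ℕ∞) + M.eRk (T ∪ T') ≤ M.eRk (T ∩ T') + M.eRk (T ∪ T') := by gcongr
        _ ≤ 2 + 2 := h4
    exact (ENat.add_le_add_iff_left (by simp)).1 h5
  have hun3 : (T ∪ T').ncard ≤ 3 := by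
    have := ThmN.ncard_add_one_le_two_pow_of_eRk_le M (ThmN.not_isLoop_of_free M hfree) hfree 2
      (T ∪ T') (union_subset hT hT') hun
    omega
  have hTeq : T ∪ T' = T :=
    (eq_of_subset_of_ncard_le subset_union_left (by omega) (hTfin.union hT'fin)).symm
  have hT'T : T' ⊆ T := by rw [← hTeq]; exact subset_union_right
  exact hne (eq_of_subset_of_ncard_le hT'T (by omega) hTfin).symm

/-- **Every point of a 6-point plane of the e-free core lies on a rank-`2` triple of the plane.** -/
theorem exists_triple_through_of_ncard_six (M : Matroid α) [M.Finite]
    (hfree : ∀ e ∈ M.E, ∃ A ⊆ M.E \ {e}, e ∉ M.closure A ∧ e ∉ M.closure ((M.E \ {e}) \ A))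
    {P : Set α} (hP : P ⊆ M.E) (hr : M.eRk P ≤ 3) (h6 : P.ncard = 6) {y : α} (hy : y ∈ P) :
    ∃ u ∈ P, ∃ v ∈ P, u ≠ v ∧ u ≠ y ∧ v ≠ y ∧ M.eRk {y, u, v} ≤ 2 := by
  classical
  by_contra hno
  push Not at hno
  have hPfin : P.Finite := M.ground_finite.subset hP
  have hLS2 : ∀ X ⊆ M.E, M.eRk X ≤ 2 → X.ncard ≤ 3 := by
    intro X hX h
    have := ThmN.ncard_add_one_le_two_pow_of_eRk_le M (ThmN.not_isLoop_of_free M hfree) hfree 2 X hX h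
    omega
  set Q := P \ {y} with hQ
  have hQP : Q ⊆ P := sdiff_subset
  have hQfin : Q.Finite := hPfin.subset hQP
  have hQ5 : Q.ncard = 5 := by
    have := ncard_sdiff_singleton_add_one hy hPfin
    rw [← hQ] at this
    omega
  -- every `z ∈ Q` misses a rank-`2` triple inside `Q`
  have hmiss : ∀ z ∈ Q, ∃ T : Set α, T ⊆ Q \ {z} ∧ M.eRk T ≤ 2 ∧ T.ncard = 3 := by
    intro z hz
    have hzP : z ∈ P := hz.1
    obtain ⟨S, T, hS, hT, hcov, _, hrS, hrT⟩ := ThmN.exists_two_sides_of_free M hfree hP (k := 2) hr hzP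
    have hSfin : S.Finite := hPfin.subset (hS.trans sdiff_subset)
    have hTfin : T.Finite := hPfin.subset (hT.trans sdiff_subset)
    have hS3 : S.ncard ≤ 3 := hLS2 S (hS.trans (sdiff_subset.trans hP)) hrS
    have hT3 : T.ncard ≤ 3 := hLS2 T (hT.trans (sdiff_subset.trans hP)) hrT
    have h5 : (P \ {z}).ncard = 5 := by
      have := ncard_sdiff_singleton_add_one hzP hPfin
      omega
    have hcard : (P \ {z}).ncard ≤ S.ncard + T.ncard :=
      (ncard_le_ncard hcov (hSfin.union hTfin)).trans (ncard_union_le S T)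
    -- a 3-point side avoids `y`: otherwise it is a rank-2 triple through `y`
    have hkey : ∀ S' : Set α, S' ⊆ P \ {z} → M.eRk S' ≤ 2 → S'.ncard = 3 → S' ⊆ Q \ {z} := by
      intro S' hS' hrS' hS'3 w hw
      refine ⟨⟨(hS' hw).1, ?_⟩, (hS' hw).2⟩
      intro hwy
      rw [mem_singleton_iff] at hwy
      subst hwy
      obtain ⟨a, b, c, hab, hac, hbc, hS'eq⟩ := ncard_eq_three.1 hS'3
      -- `w ∈ S' = {a, b, c}`: the other two points give the triple
      have hwS' : w ∈ ({a, b, c} : Set α) := hS'eq ▸ hw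
      have hsub : ∀ u ∈ S', ∀ v ∈ S', u ≠ v → u ≠ w → v ≠ w → False := by
        intro u hu v hv huv huw hvw
        have huP : u ∈ P := (hS' hu).1
        have hvP : v ∈ P := (hS' hv).1
        have hT : ({w, u, v} : Set α) ⊆ S' := by
          intro t ht
          simp only [mem_insert_iff, mem_singleton_iff] at ht
          rcases ht with rfl | rfl | rfl
          · exact hw
          · exact hu
          · exact hv
        exact absurd ((M.eRk_mono hT).trans hrS') (not_le.2 (hno u huP v hvP huv huw hvw))
      simp only [mem_insert_iff, mem_singleton_iff] at hwS'
      rcases hwS' with rfl | rfl | rfl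
      · exact hsub b (by rw [hS'eq]; simp) c (by rw [hS'eq]; simp) hbc hab.symm hac.symm
      · exact hsub a (by rw [hS'eq]; simp) c (by rw [hS'eq]; simp) hac hab hbc.symm
      · exact hsub a (by rw [hS'eq]; simp) b (by rw [hS'eq]; simp) hab hac hbc
    rcases Nat.lt_or_ge S.ncard 3 with hSlt | hSge
    · have hT3' : T.ncard = 3 := by omega
      exact ⟨T, hkey T hT hrT hT3', hrT, hT3'⟩
    · have hS3' : S.ncard = 3 := by omega
      exact ⟨S, hkey S hS hrS hS3', hrS, hS3'⟩
  -- pairwise: distinct triples inside `Q` share `≤ 1` point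
  have hshare : ∀ T T' : Set α, T ⊆ Q → T' ⊆ Q → M.eRk T ≤ 2 → M.eRk T' ≤ 2 → T.ncard = 3 → T'.ncard = 3 →
      T ≠ T' → (T ∩ T').ncard ≤ 1 :=
    fun T T' hT hT' hrT hrT' h3 h3' hne =>
      inter_ncard_le_one_of_triples M hfree (hT.trans (hQP.trans hP)) (hT'.trans (hQP.trans hP)) hrT hrT' h3 h3' hne
  -- chase three triples
  obtain ⟨z₁, hz₁⟩ : Q.Nonempty := by
    rw [nonempty_iff_ne_empty]; intro h; rw [h] at hQ5; simp at hQ5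
  obtain ⟨T₁, hT₁, hrT₁, hT₁3⟩ := hmiss z₁ hz₁
  obtain ⟨a, b, c, hab, hac, hbc, hT₁eq⟩ := ncard_eq_three.1 hT₁3
  have haT₁ : a ∈ T₁ := by rw [hT₁eq]; simp
  have hbT₁ : b ∈ T₁ := by rw [hT₁eq]; simp
  have hcT₁ : c ∈ T₁ := by rw [hT₁eq]; simp
  have hT₁Q : T₁ ⊆ Q := hT₁.trans sdiff_subset
  have hz₁T₁ : z₁ ∉ T₁ := fun h => (hT₁ h).2 rfl
  -- the fifth point `d`
  have hQ4 : (Q \ T₁).ncard = 2 := by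
    have := ncard_sdiff_add_ncard_of_subset hT₁Q hQfin
    omega
  have hz₁d : z₁ ∈ Q \ T₁ := ⟨hz₁, hz₁T₁⟩
  obtain ⟨d, hdQT, hdz₁⟩ := exists_ne_of_one_lt_ncard (by omega : 1 < (Q \ T₁).ncard) z₁
  have hQeq : Q = {z₁, d} ∪ T₁ := by
    apply (eq_of_subset_of_ncard_le ?_ ?_ hQfin).symm
    · intro t ht
      simp only [mem_union, mem_insert_iff, mem_singleton_iff] at ht
      rcases ht with (rfl | rfl) | h
      · exact hz₁
      · exact hdQT.1
      · exact hT₁Q h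
    · have hdisj : Disjoint ({z₁, d} : Set α) T₁ := by
        rw [disjoint_left]
        intro t ht
        simp only [mem_insert_iff, mem_singleton_iff] at ht
        rcases ht with rfl | rfl
        · exact hz₁T₁
        · exact hdQT.2
      have h1 : ({z₁, d} ∪ T₁).ncard = ({z₁, d} : Set α).ncard + T₁.ncard :=
        ncard_union_eq hdisj (toFinite _) (hQfin.subset hT₁Q)
      have h2 : ({z₁, d} : Set α).ncard = 2 := ncard_pair hdz₁.symm
      omega
  -- the triple missed by `a`
  obtain ⟨T₂, hT₂, hrT₂, hT₂3⟩ := hmiss a (hT₁Q haT₁)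
  have hT₂Q : T₂ ⊆ Q := hT₂.trans sdiff_subset
  have haT₂ : a ∉ T₂ := fun h => (hT₂ h).2 rfl
  have hT₂ne : T₂ ≠ T₁ := fun h => haT₂ (h ▸ haT₁)
  have hshare₂ := hshare T₂ T₁ hT₂Q hT₁Q hrT₂ hrT₁ hT₂3 hT₁3 hT₂ne
  -- `T₂` contains `z₁` and `d` and exactly one of `b, c`
  have hT₂sub : T₂ ⊆ {z₁, d} ∪ T₁ := hQeq ▸ hT₂Q
  have hT₂split : T₂ ⊆ ({z₁, d} ∪ (T₂ ∩ T₁)) := by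
    intro t ht
    rcases hT₂sub ht with h | h
    · exact Or.inl h
    · exact Or.inr ⟨ht, h⟩
  have hT₂card : T₂.ncard ≤ ({z₁, d} : Set α).ncard + (T₂ ∩ T₁).ncard :=
    (ncard_le_ncard hT₂split ((toFinite _).union (hQfin.subset (inter_subset_left.trans hT₂Q)))).trans
      (ncard_union_le _ _)
  have hzd2 : ({z₁, d} : Set α).ncard = 2 := ncard_pair hdz₁.symm
  have hT₂T₁1 : (T₂ ∩ T₁).ncard = 1 := by omega
  have hz₁T₂ : z₁ ∈ T₂ := by
    by_contra h
    have : T₂ ⊆ {d} ∪ (T₂ ∩ T₁) := by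
      intro t ht
      rcases hT₂split ht with h' | h'
      · simp only [mem_insert_iff, mem_singleton_iff] at h'
        rcases h' with rfl | rfl
        · exact absurd ht h
        · exact Or.inl rfl
      · exact Or.inr h'
    have := (ncard_le_ncard this ((toFinite _).union (hQfin.subset (inter_subset_left.trans hT₂Q)))).trans
      (ncard_union_le _ _)
    rw [ncard_singleton] at this
    omega
  have hdT₂ : d ∈ T₂ := by
    by_contra h
    have : T₂ ⊆ {z₁} ∪ (T₂ ∩ T₁) := by
      intro t ht
      rcases hT₂split ht with h' | h'
      · simp only [mem_insert_iff, mem_singleton_iff] at h'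
        rcases h' with rfl | rfl
        · exact Or.inl rfl
        · exact absurd ht h
      · exact Or.inr h'
    have := (ncard_le_ncard this ((toFinite _).union (hQfin.subset (inter_subset_left.trans hT₂Q)))).trans
      (ncard_union_le _ _)
    rw [ncard_singleton] at this
    omega
  -- the point of `T₂ ∩ T₁` is `b` or `c`; by symmetry call it `b'` and the other `c'`
  obtain ⟨w, hweq⟩ := ncard_eq_one.1 hT₂T₁1
  have hwT₂ : w ∈ T₂ := (hweq ▸ (mem_singleton w) : w ∈ T₂ ∩ T₁).1
  have hwT₁ : w ∈ T₁ := (hweq ▸ (mem_singleton w) : w ∈ T₂ ∩ T₁).2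
  have hwa : w ≠ a := fun h => haT₂ (h ▸ hwT₂)
  have hT₂eq : T₂ = {z₁, d, w} := by
    apply (eq_of_subset_of_ncard_le ?_ ?_ (hQfin.subset hT₂Q)).symm
    · intro t ht
      simp only [mem_insert_iff, mem_singleton_iff] at ht
      rcases ht with rfl | rfl | rfl
      · exact hz₁T₂
      · exact hdT₂
      · exact hwT₂
    · have hwz : w ≠ z₁ := fun h => hz₁T₁ (h ▸ hwT₁)
      have hwd : w ≠ d := fun h => hdQT.2 (h ▸ hwT₁)
      have : ({z₁, d, w} : Set α).ncard = 3 :=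
        ncard_eq_three.2 ⟨z₁, d, w, hdz₁.symm, hwz.symm, hwd.symm, rfl⟩
      omega
  -- the triple missed by `w` itself: it meets `T₁` and `T₂` in `≤ 1` point each, yet `Q = {z₁, d} ∪ T₁ ⊆ T₂ ∪ T₁`
  obtain ⟨T₃, hT₃, hrT₃, hT₃3⟩ := hmiss w (hT₁Q hwT₁)
  have hT₃Q : T₃ ⊆ Q := hT₃.trans sdiff_subset
  have hwT₃ : w ∉ T₃ := fun h => (hT₃ h).2 rfl
  have hT₃ne₁ : T₃ ≠ T₁ := fun h => hwT₃ (h ▸ hwT₁)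
  have hT₃ne₂ : T₃ ≠ T₂ := fun h => hwT₃ (h ▸ hwT₂)
  have h31 := hshare T₃ T₁ hT₃Q hT₁Q hrT₃ hrT₁ hT₃3 hT₁3 hT₃ne₁
  have h32 := hshare T₃ T₂ hT₃Q hT₂Q hrT₃ hrT₂ hT₃3 hT₂3 hT₃ne₂
  have hT₃sub : T₃ ⊆ (T₃ ∩ T₂) ∪ (T₃ ∩ T₁) := by
    intro t ht
    have htQ : t ∈ Q := hT₃Q ht
    rw [hQeq] at htQ
    rcases htQ with h | h
    · refine Or.inl ⟨ht, ?_⟩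
      rw [hT₂eq]
      simp only [mem_insert_iff, mem_singleton_iff] at h ⊢
      rcases h with rfl | rfl
      · exact Or.inl rfl
      · exact Or.inr (Or.inl rfl)
    · exact Or.inr ⟨ht, h⟩
  have hT₃fin : T₃.Finite := hQfin.subset hT₃Q
  have := (ncard_le_ncard hT₃sub ((hT₃fin.subset inter_subset_left).union (hT₃fin.subset inter_subset_left))).trans
    (ncard_union_le _ _)
  omega

end S1

end PercRepro
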